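import Literature.NumberTheory.GaloisRepresentations.RayClassGroupModulusChange
import Literature.NumberTheory.EllipticCurves.ProfiniteGroupDistributionCharacterCellsIndex
import Literature.NumberTheory.LFunctions.CubicRayClassCharacterCount
import Mathlib.LinearAlgebra.FreeModule.IdealQuotient
import HarnessLib

/-!
# `#ker((𝓞/𝔣𝔭^{n+1})ˣ → (𝓞/𝔣𝔭)ˣ) = p^n` at a prime `𝔭` of degree one, unramified over `p`;
# hence `#Cl_K^{𝔣𝔭^{n+1}} = #Cl_K^{𝔣𝔭} · p^n`
# (de Shalit 1987, II.1.9: `[K(𝔣𝔭^{n+1}) : K(𝔣𝔭)] = #(1+𝔭)/(1+𝔭^{n+1})`)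

De Shalit, *Iwasawa theory of elliptic curves with complex multiplication* (1987), II.1.9 / II.4.6
(p. 43, 59): for a split prime `𝔭` of the imaginary quadratic field `K` (`𝒪_𝔭 = ℤ_p`) and `𝔣`
prime to `𝔭` with `w_𝔣 = 1`, `Gal(K(𝔣𝔭^{n+1})/K(𝔣𝔭)) ≅ (1 + 𝔭)/(1 + 𝔭^{n+1}) ≅ (1+pℤ_p)/(1+p^{n+1}ℤ_p)`,
of order `p^n`. `RayClassGroupModulusChange.lean` reduced the ray class number ratio
`#Cl^{𝔪'}/#Cl^{𝔪}` (`𝔪 = 𝔣𝔭`, `𝔪' = 𝔣𝔭^{n+1}`) to `#ker((𝓞/𝔪')ˣ → (𝓞/𝔪)ˣ)`; this file computes that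
kernel:

* §1 `natCard_ker_unitsMap_factor_eq_of_coprime` — **localisation at `𝔭`**: for `𝔣` prime to `𝔭`,
  `#ker((𝓞/𝔣𝔭^{n+1})ˣ → (𝓞/𝔣𝔭)ˣ) = #ker((𝓞/𝔭^{n+1})ˣ → (𝓞/𝔭)ˣ)` (explicit bijection by the Chinese
  remainder theorem on elements, `LFunctions.exists_sub_mem_and_sub_mem`);
* §2 `natCast_mem_pow_iff`, `charP_quotient_pow` — for `𝔭` unramified over `p` (`v_𝔭(p) = 1`):
  `x ∈ 𝔭^k ↔ p^k ∣ x` for `x ∈ ℕ`, so `char(𝓞/𝔭^k) = p^k`; with `#(𝓞/𝔭) = p` (degree one,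
  `natCard_quotient_pow_eq`: `#(𝓞/𝔭^k) = p^k`) **`nonempty_ringEquiv_zmod_quotient_pow`**:
  `ℤ/p^k ≃+* 𝓞/𝔭^k` (compatibility with the reductions is automatic: `Subsingleton (ZMod n →+* R)`);
* §3 ★ `natCard_ker_unitsMap_factor_pow` — **`#ker((𝓞/𝔭^{n+1})ˣ → (𝓞/𝔭)ˣ) = p^n`** (transport to
  `(ℤ/p^{n+1})ˣ → (ℤ/p)ˣ` and `PadicInt.natCard_ker_unitsMap`);
* §4 ★★ **`natCard_rayClassGroup_mul_pow_eq`**: `#Cl_K^{𝔣𝔭^{n+1}} = #Cl_K^{𝔣𝔭} · p^n` for `K` totally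
  complex, `w_{𝔣𝔭} = 1`, `𝔭` of degree one unramified over `p`, `𝔣` prime to `𝔭`.

Everything is a theorem; no definitions, no named facts, no instances, no `sorry`.

## References

* [deShalit1987] E. de Shalit, *Iwasawa theory of elliptic curves with complex multiplication* (1987),
  II.1.9 (p. 43), II.4.6 (p. 59).
* [NeukirchANT1999] J. Neukirch, *Algebraic Number Theory* (1999), Ch. VI §1 Prop. (1.9), Exercise 13.
-/

noncomputable section

open NumberField IsDedekindDomain IsDedekindDomain.HeightOneSpectrum
open scoped nonZeroDivisors Classical

namespace Literature.NumberTheory.GaloisRepresentations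

variable {K : Type*} [Field K] [NumberField K]

/-! ### §1. Localisation at `𝔭`: the `𝔣`-component of a kernel class is trivial -/

omit [NumberField K] in
/-- An element prime to `I` is a unit modulo `I`. [cite: NeukirchANT1999, Ch. VI §1 Prop. (1.9)] -/
theorem isUnit_mk_of_isCoprime_span_singleton {I : Ideal (𝓞 K)} {r : 𝓞 K}
    (h : IsCoprime (Ideal.span {r}) I) : IsUnit (Ideal.Quotient.mk I r) := by
  obtain ⟨i, hi, j, hj, hij⟩ := Ideal.isCoprime_iff_exists.mp h
  obtain ⟨d, rfl⟩ := Ideal.mem_span_singleton'.mp hi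
  refine IsUnit.of_mul_eq_one (Ideal.Quotient.mk I d) ?_
  rw [← map_mul, ← map_one (Ideal.Quotient.mk I), Ideal.Quotient.eq]
  have : r * d - 1 = -j := by rw [← hij]; ring
  rw [this]; exact I.neg_mem hj

/-- **`#ker((𝓞/𝔣𝔞')ˣ → (𝓞/𝔣𝔞)ˣ) = #ker((𝓞/𝔞')ˣ → (𝓞/𝔞)ˣ)`** for `𝔞' ≤ 𝔞` and `𝔣` prime to `𝔞'`:
the kernel does not see the `𝔣`-component (Chinese remainder theorem; explicit bijection by
`x ↦ x mod 𝔞'`). [cite: NeukirchANT1999, Ch. VI §1 Prop. (1.9)] [cite: deShalit1987, II.1.9 (p. 43)] -/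
theorem natCard_ker_unitsMap_factor_eq_of_coprime {𝔣 𝔞 𝔞' : Ideal (𝓞 K)} (hle : 𝔞' ≤ 𝔞)
    (hcop : IsCoprime 𝔣 𝔞') :
    Nat.card (Units.map (Ideal.Quotient.factor (Ideal.mul_mono_right hle : 𝔣 * 𝔞' ≤ 𝔣 * 𝔞)).toMonoidHom :
        (𝓞 K ⧸ 𝔣 * 𝔞')ˣ →* (𝓞 K ⧸ 𝔣 * 𝔞)ˣ).ker =
      Nat.card (Units.map (Ideal.Quotient.factor hle).toMonoidHom :
        (𝓞 K ⧸ 𝔞')ˣ →* (𝓞 K ⧸ 𝔞)ˣ).ker := by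
  have h₁ : 𝔣 * 𝔞' ≤ 𝔞' := Ideal.mul_le_left
  have hfa : 𝔣 * 𝔞 ≤ 𝔞 := Ideal.mul_le_left
  have hff : 𝔣 * 𝔞 ≤ 𝔣 := Ideal.mul_le_right
  have hcopa : IsCoprime 𝔣 𝔞 := hcop.mono dvd_rfl (Ideal.dvd_iff_le.mpr hle)
  set red := (Units.map (Ideal.Quotient.factor (Ideal.mul_mono_right hle : 𝔣 * 𝔞' ≤ 𝔣 * 𝔞)).toMonoidHom :
    (𝓞 K ⧸ 𝔣 * 𝔞')ˣ →* (𝓞 K ⧸ 𝔣 * 𝔞)ˣ) with hred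
  set redv := (Units.map (Ideal.Quotient.factor hle).toMonoidHom : (𝓞 K ⧸ 𝔞')ˣ →* (𝓞 K ⧸ 𝔞)ˣ)
    with hredv
  -- representatives
  have hrep : ∀ x : red.ker, ∃ r : 𝓞 K, Ideal.Quotient.mk (𝔣 * 𝔞') r = ((x : (𝓞 K ⧸ 𝔣 * 𝔞')ˣ) : _) :=
    fun x ↦ Ideal.Quotient.mk_surjective _
  choose r hr using hrep
  have hr1 : ∀ x : red.ker, r x - 1 ∈ 𝔣 * 𝔞 := fun x ↦ by
    have hx : red x = 1 := x.2
    have h := congrArg (fun u : (𝓞 K ⧸ 𝔣 * 𝔞)ˣ ↦ (u : 𝓞 K ⧸ 𝔣 * 𝔞)) hx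
    simp only [hred, Units.coe_map, RingHom.toMonoidHom_eq_coe, MonoidHom.coe_coe, Units.val_one, ← hr,
      Ideal.Quotient.factor_mk] at h
    rwa [← map_one (Ideal.Quotient.mk (𝔣 * 𝔞)), Ideal.Quotient.eq] at h
  -- the map `x ↦ x mod 𝔞'`
  have hΦmem : ∀ x : red.ker,
      Units.map (Ideal.Quotient.factor h₁).toMonoidHom (x : (𝓞 K ⧸ 𝔣 * 𝔞')ˣ) ∈ redv.ker := fun x ↦ by
    rw [MonoidHom.mem_ker]
    apply Units.ext
    simp only [hredv, Units.coe_map, RingHom.toMonoidHom_eq_coe, MonoidHom.coe_coe, Units.val_one, ← hr,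
      Ideal.Quotient.factor_mk]
    rw [← map_one (Ideal.Quotient.mk 𝔞), Ideal.Quotient.eq]
    exact hfa (hr1 x)
  let Φ : red.ker → redv.ker := fun x ↦ ⟨_, hΦmem x⟩
  have hΦval : ∀ x : red.ker, (((Φ x : redv.ker) : (𝓞 K ⧸ 𝔞')ˣ) : 𝓞 K ⧸ 𝔞') =
      Ideal.Quotient.mk 𝔞' (r x) := fun x ↦ by
    change ((Units.map (Ideal.Quotient.factor h₁).toMonoidHom (x : (𝓞 K ⧸ 𝔣 * 𝔞')ˣ) : (𝓞 K ⧸ 𝔞')ˣ) :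
      𝓞 K ⧸ 𝔞') = _
    rw [Units.coe_map, RingHom.toMonoidHom_eq_coe, MonoidHom.coe_coe, ← hr, Ideal.Quotient.factor_mk]
  refine Nat.card_congr (Equiv.ofBijective Φ ⟨?_, ?_⟩)
  · -- injective: `r x ≡ r y mod 𝔞'` and `mod 𝔣` ⟹ `mod 𝔣𝔞' = 𝔣 ⊓ 𝔞'`
    intro x y hxy
    have h := congrArg (fun u : redv.ker ↦ (((u : (𝓞 K ⧸ 𝔞')ˣ) : 𝓞 K ⧸ 𝔞'))) hxy
    simp only [hΦval, Ideal.Quotient.eq] at h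
    apply Subtype.ext; apply Units.ext
    rw [← hr x, ← hr y, Ideal.Quotient.eq, Ideal.mul_eq_inf_of_isCoprime hcop]
    refine ⟨?_, h⟩
    have : r x - r y = (r x - 1) - (r y - 1) := by ring
    rw [this]
    exact 𝔣.sub_mem (hff (hr1 x)) (hff (hr1 y))
  · -- surjective: CRT with `x ≡ s mod 𝔞'`, `x ≡ 1 mod 𝔣`
    intro y
    obtain ⟨s, hs⟩ := Ideal.Quotient.mk_surjective (((y : redv.ker) : (𝓞 K ⧸ 𝔞')ˣ) : 𝓞 K ⧸ 𝔞')
    have hsu : IsUnit (Ideal.Quotient.mk 𝔞' s) := by rw [hs]; exact Units.isUnit _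
    have hs1 : s - 1 ∈ 𝔞 := by
      have hy : redv y = 1 := y.2
      have h := congrArg (fun u : (𝓞 K ⧸ 𝔞)ˣ ↦ (u : 𝓞 K ⧸ 𝔞)) hy
      simp only [hredv, Units.coe_map, RingHom.toMonoidHom_eq_coe, MonoidHom.coe_coe, Units.val_one, ← hs,
        Ideal.Quotient.factor_mk] at h
      rwa [← map_one (Ideal.Quotient.mk 𝔞), Ideal.Quotient.eq] at h
    obtain ⟨x, hxs, hx1⟩ := Literature.NumberTheory.LFunctions.exists_sub_mem_and_sub_mem hcop.symm s 1
    -- `x` is a unit mod `𝔣𝔞'`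
    have hxcopf : IsCoprime (Ideal.span {x}) 𝔣 :=
      Ideal.isCoprime_iff_exists.mpr ⟨x, Ideal.mem_span_singleton_self x, 1 - x, by
        have : 1 - x = -(x - 1) := by ring
        rw [this]; exact 𝔣.neg_mem hx1, by ring⟩
    have hxcopa : IsCoprime (Ideal.span {x}) 𝔞' := by
      obtain ⟨i, hi, j, hj, hij⟩ := Ideal.isCoprime_iff_exists.mp (isCoprime_span_of_isUnit_mk hsu)
      obtain ⟨d, rfl⟩ := Ideal.mem_span_singleton'.mp hi
      refine Ideal.isCoprime_iff_exists.mpr ⟨d * x, Ideal.mem_span_singleton'.mpr ⟨d, rfl⟩,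
        j + d * (s - x), 𝔞'.add_mem hj (𝔞'.mul_mem_left _ ?_), by rw [← hij]; ring⟩
      have : s - x = -(x - s) := by ring
      rw [this]; exact 𝔞'.neg_mem hxs
    have hxu : IsUnit (Ideal.Quotient.mk (𝔣 * 𝔞') x) :=
      isUnit_mk_of_isCoprime_span_singleton (hxcopf.mul_right hxcopa)
    have hxker : hxu.unit ∈ red.ker := by
      rw [MonoidHom.mem_ker]
      apply Units.ext
      simp only [hred, Units.coe_map, RingHom.toMonoidHom_eq_coe, MonoidHom.coe_coe, Units.val_one,
        IsUnit.unit_spec, Ideal.Quotient.factor_mk]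
      rw [← map_one (Ideal.Quotient.mk (𝔣 * 𝔞)), Ideal.Quotient.eq, Ideal.mul_eq_inf_of_isCoprime hcopa]
      refine ⟨hx1, ?_⟩
      have : x - 1 = (x - s) + (s - 1) := by ring
      rw [this]
      exact 𝔞.add_mem (hle hxs) hs1
    refine ⟨⟨hxu.unit, hxker⟩, ?_⟩
    apply Subtype.ext; apply Units.ext
    rw [hΦval, ← hs, Ideal.Quotient.eq]
    have hrx : r ⟨hxu.unit, hxker⟩ - x ∈ 𝔣 * 𝔞' := by
      rw [← Ideal.Quotient.eq, hr]
      rfl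
    have : r ⟨hxu.unit, hxker⟩ - s = (r ⟨hxu.unit, hxker⟩ - x) + (x - s) := by ring
    rw [this]
    exact 𝔞'.add_mem (h₁ hrx) hxs

/-! ### §2. `𝓞/𝔭^k ≅ ℤ/p^k` for `𝔭` of degree one, unramified over `p` -/

section PrimePower

variable (v : HeightOneSpectrum (𝓞 K)) {p : ℕ} [Fact p.Prime]

omit [Fact p.Prime] in
/-- `#(𝓞/𝔭^k) = p^k` when `#(𝓞/𝔭) = p` (multiplicativity of the absolute norm).
[cite: NeukirchANT1999, Ch. I §6 Prop. (6.1)] -/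
theorem natCard_quotient_pow_eq (hdeg : Nat.card (𝓞 K ⧸ v.asIdeal) = p) (k : ℕ) :
    Nat.card (𝓞 K ⧸ v.asIdeal ^ k) = p ^ k := by
  have h : Ideal.absNorm (v.asIdeal ^ k) = Ideal.absNorm v.asIdeal ^ k := map_pow _ _ _
  rw [Ideal.absNorm_apply, Ideal.absNorm_apply, Submodule.cardQuot_apply, Submodule.cardQuot_apply] at h
  rw [← hdeg]
  exact h

/-- For `𝔭` unramified of degree one over `p` (`v_𝔭(p) = 1`): an integer `x` lies in `𝔭^k` iff
`p^k ∣ x`. [cite: NeukirchANT1999, Ch. I §8 Prop. (8.3)] -/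
theorem natCast_mem_pow_iff (hval : v.intValuation ((p : ℕ) : 𝓞 K) = WithZero.exp (-1 : ℤ))
    (k x : ℕ) : ((x : ℕ) : 𝓞 K) ∈ v.asIdeal ^ k ↔ p ^ k ∣ x := by
  have hp : p.Prime := Fact.out
  rcases Nat.eq_zero_or_pos x with rfl | hx0
  · simp
  obtain ⟨a, m, hm, rfl⟩ := Nat.exists_eq_pow_mul_and_not_dvd hx0.ne' p hp.ne_one
  -- `v(m) = 1`: otherwise `m, p ∈ 𝔭` coprime would give `1 ∈ 𝔭`
  have hpv : ((p : ℕ) : 𝓞 K) ∈ v.asIdeal := by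
    rw [← intValuation_lt_one_iff_mem, hval, ← WithZero.exp_zero, WithZero.exp_lt_exp]
    norm_num
  have hmv : ((m : ℕ) : 𝓞 K) ∉ v.asIdeal := by
    intro hmem
    have hcop : Nat.Coprime p m := (Nat.Prime.coprime_iff_not_dvd hp).mpr hm
    obtain ⟨a', b', hab⟩ := Nat.isCoprime_iff_coprime.mpr hcop
    have h1 : (1 : 𝓞 K) ∈ v.asIdeal := by
      have : ((a' * p + b' * m : ℤ) : 𝓞 K) = 1 := by rw [hab]; simp
      rw [← this]
      push_cast
      exact v.asIdeal.add_mem (v.asIdeal.mul_mem_left _ hpv) (v.asIdeal.mul_mem_left _ hmem)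
    exact v.isPrime.ne_top ((Ideal.eq_top_iff_one _).mpr h1)
  have hvx : v.intValuation (((p ^ a * m : ℕ) : ℕ) : 𝓞 K) = WithZero.exp (-(a : ℤ)) := by
    rw [Nat.cast_mul, Nat.cast_pow, map_mul, map_pow, hval, intValuation_eq_one_iff.mpr hmv, mul_one,
      ← WithZero.exp_nsmul, nsmul_eq_mul, mul_neg, mul_one]
  rw [← intValuation_le_pow_iff_mem, hvx, WithZero.exp_le_exp, neg_le_neg_iff, Int.ofNat_le]
  constructor
  · intro hka
    exact (pow_dvd_pow p hka).mul_right m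
  · intro hdvd
    have hcop : Nat.Coprime (p ^ k) m := Nat.Coprime.pow_left k ((Nat.Prime.coprime_iff_not_dvd hp).mpr hm)
    have h := hcop.dvd_of_dvd_mul_right hdvd
    exact (Nat.pow_dvd_pow_iff_le_right hp.one_lt).mp h

/-- `char(𝓞/𝔭^k) = p^k` for `𝔭` unramified of degree one over `p`.
[cite: NeukirchANT1999, Ch. I §8 Prop. (8.3)] -/
theorem charP_quotient_pow (hval : v.intValuation ((p : ℕ) : 𝓞 K) = WithZero.exp (-1 : ℤ)) (k : ℕ) :
    CharP (𝓞 K ⧸ v.asIdeal ^ k) (p ^ k) :=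
  ⟨fun x ↦ by rw [← map_natCast (Ideal.Quotient.mk (v.asIdeal ^ k)), Ideal.Quotient.eq_zero_iff_mem,
    natCast_mem_pow_iff v hval]⟩

/-- **`ℤ/p^k ≅ 𝓞/𝔭^k`** for `𝔭` of degree one (`#(𝓞/𝔭) = p`) unramified over `p` (`v_𝔭(p) = 1`): the
unique ring isomorphism (de Shalit's `𝒪_𝔭 = ℤ_p` at a split prime, read at finite level).
[cite: deShalit1987, II.1.9 (p. 43)] [cite: NeukirchANT1999, Ch. I §8 Prop. (8.3)] -/
theorem nonempty_ringEquiv_zmod_quotient_pow (hdeg : Nat.card (𝓞 K ⧸ v.asIdeal) = p)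
    (hval : v.intValuation ((p : ℕ) : 𝓞 K) = WithZero.exp (-1 : ℤ)) (k : ℕ) :
    Nonempty (ZMod (p ^ k) ≃+* 𝓞 K ⧸ v.asIdeal ^ k) := by
  have hp : p.Prime := Fact.out
  haveI : Finite (𝓞 K ⧸ v.asIdeal ^ k) :=
    Ideal.finiteQuotientOfFreeOfNeBot _ (pow_ne_zero _ v.ne_bot)
  letI : Fintype (𝓞 K ⧸ v.asIdeal ^ k) := Fintype.ofFinite _
  haveI := charP_quotient_pow v hval k
  refine ⟨ZMod.ringEquiv (𝓞 K ⧸ v.asIdeal ^ k) ?_⟩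
  rw [← Nat.card_eq_fintype_card, natCard_quotient_pow_eq v hdeg]

/-! ### §3. `#ker((𝓞/𝔭^{n+1})ˣ → (𝓞/𝔭)ˣ) = p^n` -/

/-- ★ **`#ker((𝓞/𝔭^{n+1})ˣ → (𝓞/𝔭^1)ˣ) = p^n`** for `𝔭` of degree one unramified over `p`: transport
along `ℤ/p^{n+1} ≅ 𝓞/𝔭^{n+1}`, `ℤ/p ≅ 𝓞/𝔭` (ring maps out of `ℤ/p^{n+1}` are unique, so the
reductions correspond) to `#ker((ℤ/p^{n+1})ˣ → (ℤ/p)ˣ) = p^n` (`PadicInt.natCard_ker_unitsMap`).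
[cite: deShalit1987, II.1.9 (p. 43)] -/
theorem natCard_ker_unitsMap_factor_pow (hdeg : Nat.card (𝓞 K ⧸ v.asIdeal) = p)
    (hval : v.intValuation ((p : ℕ) : 𝓞 K) = WithZero.exp (-1 : ℤ)) (n : ℕ) :
    Nat.card (Units.map (Ideal.Quotient.factor
        (Ideal.pow_le_pow_right (Nat.le_add_left 1 n) : v.asIdeal ^ (n + 1) ≤ v.asIdeal ^ 1)).toMonoidHom :
        (𝓞 K ⧸ v.asIdeal ^ (n + 1))ˣ →* (𝓞 K ⧸ v.asIdeal ^ 1)ˣ).ker = p ^ n := by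
  obtain ⟨e'⟩ := nonempty_ringEquiv_zmod_quotient_pow v hdeg hval (n + 1)
  obtain ⟨e⟩ := nonempty_ringEquiv_zmod_quotient_pow v hdeg hval 1
  set redv := (Units.map (Ideal.Quotient.factor
      (Ideal.pow_le_pow_right (Nat.le_add_left 1 n) : v.asIdeal ^ (n + 1) ≤ v.asIdeal ^ 1)).toMonoidHom :
      (𝓞 K ⧸ v.asIdeal ^ (n + 1))ˣ →* (𝓞 K ⧸ v.asIdeal ^ 1)ˣ) with hredv
  set uZ := (ZMod.unitsMap (pow_dvd_pow p (Nat.le_add_left 1 n)) :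
      (ZMod (p ^ (n + 1)))ˣ →* (ZMod (p ^ 1))ˣ) with huZ
  set E' : (ZMod (p ^ (n + 1)))ˣ →* (𝓞 K ⧸ v.asIdeal ^ (n + 1))ˣ := Units.map e'.toRingHom.toMonoidHom
    with hE'
  set E : (ZMod (p ^ 1))ˣ →* (𝓞 K ⧸ v.asIdeal ^ 1)ˣ := Units.map e.toRingHom.toMonoidHom with hE
  -- the reductions correspond: `redv ∘ E' = E ∘ uZ` (ring maps out of `ℤ/p^{n+1}` are unique)
  have hsq : (Ideal.Quotient.factor (Ideal.pow_le_pow_right (Nat.le_add_left 1 n) :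
        v.asIdeal ^ (n + 1) ≤ v.asIdeal ^ 1)).comp e'.toRingHom =
      e.toRingHom.comp (ZMod.castHom (pow_dvd_pow p (Nat.le_add_left 1 n)) (ZMod (p ^ 1))) :=
    Subsingleton.elim _ _
  have hcomp : redv.comp E' = E.comp uZ := by
    ext x
    have h := RingHom.congr_fun hsq (x : ZMod (p ^ (n + 1)))
    simpa [hredv, hE', hE, huZ, ZMod.unitsMap_def] using h
  have hE'surj : Function.Surjective E' := fun u ↦
    ⟨Units.map e'.symm.toRingHom.toMonoidHom u, by apply Units.ext; simp [hE']⟩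
  have hE'inj : Function.Injective E' := fun a b h ↦ by
    apply Units.ext
    have := congrArg (fun u : (𝓞 K ⧸ v.asIdeal ^ (n + 1))ˣ ↦ (u : 𝓞 K ⧸ v.asIdeal ^ (n + 1))) h
    simpa [hE'] using this
  have hEinj : Function.Injective E := fun a b h ↦ by
    apply Units.ext
    have := congrArg (fun u : (𝓞 K ⧸ v.asIdeal ^ 1)ˣ ↦ (u : 𝓞 K ⧸ v.asIdeal ^ 1)) h
    simpa [hE] using this
  calc Nat.card redv.ker
      = Nat.card (Subgroup.map E' (Subgroup.comap E' redv.ker)) := by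
          rw [Subgroup.map_comap_eq_self_of_surjective hE'surj]
    _ = Nat.card (Subgroup.comap E' redv.ker) := Subgroup.card_map_of_injective hE'inj
    _ = Nat.card (redv.comp E').ker := by rw [MonoidHom.comap_ker]
    _ = Nat.card (E.comp uZ).ker := by rw [hcomp]
    _ = Nat.card uZ.ker := by rw [MonoidHom.ker_comp_of_injective uZ E hEinj]
    _ = p ^ n := Literature.NumberTheory.EllipticCurves.PadicInt.natCard_ker_unitsMap n

end PrimePower

/-! ### §4. The ray class number ratio at a degree-one unramified prime -/

/-- ★★ **`#Cl_K^{𝔣𝔭^{n+1}} = #Cl_K^{𝔣𝔭} · p^n`** for `K` totally complex, `𝔭` a prime of degree one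
(`#(𝓞/𝔭) = p`) unramified over `p` (`v_𝔭(p) = 1`), `𝔣` prime to `𝔭`, and no unit `≠ 1` congruent to
`1 mod 𝔣𝔭` — de Shalit's `[K(𝔣𝔭^{n+1}) : K(𝔣𝔭)] = #(1+𝔭)/(1+𝔭^{n+1}) = p^n` at the level of ray class
numbers (`finrank_rayClassField` converts). [cite: deShalit1987, II.1.9 (p. 43), II.4.6 (p. 59)]
[cite: NeukirchANT1999, Ch. VI §1 Prop. (1.9)] -/
theorem natCard_rayClassGroup_mul_pow_eq [IsTotallyComplex K] (v : HeightOneSpectrum (𝓞 K)) {p : ℕ}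
    [Fact p.Prime] (hdeg : Nat.card (𝓞 K ⧸ v.asIdeal) = p)
    (hval : v.intValuation ((p : ℕ) : 𝓞 K) = WithZero.exp (-1 : ℤ))
    {𝔣 : Ideal (𝓞 K)} (h𝔣 : 𝔣 ≠ ⊥) (hcop : IsCoprime 𝔣 v.asIdeal)
    (hw : ∀ u : (𝓞 K)ˣ, (u : 𝓞 K) - 1 ∈ 𝔣 * v.asIdeal → u = 1) (n : ℕ) :
    Nat.card (RayClassGroup (𝔣 * v.asIdeal ^ (n + 1))) =
      Nat.card (RayClassGroup (𝔣 * v.asIdeal)) * p ^ n := by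
  have hv0 : v.asIdeal ≠ ⊥ := v.ne_bot
  have hle_v : v.asIdeal ^ (n + 1) ≤ v.asIdeal ^ 1 := Ideal.pow_le_pow_right (Nat.le_add_left 1 n)
  have hle : 𝔣 * v.asIdeal ^ (n + 1) ≤ 𝔣 * v.asIdeal ^ 1 := Ideal.mul_mono_right hle_v
  have h1 : 𝔣 * v.asIdeal ^ 1 = 𝔣 * v.asIdeal := by rw [pow_one]
  have h𝔪 : 𝔣 * v.asIdeal ^ 1 ≠ ⊥ := by rw [h1]; exact mul_ne_zero h𝔣 hv0
  have h𝔪' : 𝔣 * v.asIdeal ^ (n + 1) ≠ ⊥ := mul_ne_zero h𝔣 (pow_ne_zero _ hv0)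
  have h𝔪1 : 𝔣 * v.asIdeal ^ (n + 1) ≠ ⊤ := fun h ↦ v.isPrime.ne_top
    (top_le_iff.mp (h ▸ (Ideal.mul_le_left.trans (Ideal.pow_le_self (Nat.succ_ne_zero n)))))
  have hsupp : ∀ w : HeightOneSpectrum (𝓞 K),
      𝔣 * v.asIdeal ^ 1 ≤ w.asIdeal ↔ 𝔣 * v.asIdeal ^ (n + 1) ≤ w.asIdeal := fun w ↦ by
    rw [Ideal.IsPrime.mul_le w.isPrime, Ideal.IsPrime.mul_le w.isPrime,
      Ideal.IsPrime.pow_le_iff (Nat.succ_ne_zero 0), Ideal.IsPrime.pow_le_iff (Nat.succ_ne_zero n)]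
  have hw' : ∀ u : (𝓞 K)ˣ, (u : 𝓞 K) - 1 ∈ 𝔣 * v.asIdeal ^ 1 → u = 1 := by rw [h1]; exact hw
  rw [← h1, natCard_rayClassGroup_eq_mul_natCard_ker h𝔪 h𝔪' h𝔪1 hle hsupp hw',
    natCard_ker_unitsMap_factor_eq_of_coprime hle_v (hcop.pow_right (n := n + 1)),
    natCard_ker_unitsMap_factor_pow v hdeg hval n]

end Literature.NumberTheory.GaloisRepresentations

end
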